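import Literature.NumberTheory.EllipticCurves.EisensteinNumbers
import HarnessLib

/-!
# The two-index Eisenstein–Kronecker numbers `E_{j,k}(z, L)` in the absolutely convergent range
# (de Shalit II.3.1 (6), II.3.3 (i))

Topic `Literature/NumberTheory/EllipticCurves` (complex-lattice cluster), deliberate dot-notation
extensions of Mathlib's `PeriodPair`, continuing `EisensteinNumbers.lean` (`PeriodPair.areaInv = A(L)⁻¹`,
`PeriodPair.eisensteinE k = E_k = E_{0,k}`).

Printed statements (held text `book:shalit1987-iwasawa-theory-elliptic-curves-with-complex-multiplication`,
p0049–p0050): II.3.1 (5) "If `0 ≤ −j < k` … `E_{j,k}(z,L) = 𝒟^{−j}∂^{k+j−1}E₁(z,L)`"; (6)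
"`E_{j,k}(z,L) = (k−1)! A(L)^j · Σ_{ω ∈ L}(z+ω)^{−k}(z̄+ω̄)^{−j}`, `k + j ≥ 3`"; II.3.3 "(i)
`E_{j,k}(cz,cL) = c^{j−k}E_{j,k}(z,L)`".

We index by `j : ℕ` the NUMBER of conjugate factors (de Shalit's `−j ≥ 0`), so weight `= k − j`:

* `PeriodPair.eisensteinKronecker L j k z = (k−1)!·A(L)^{−j}·Σ_{ω ∈ L}(z̄ + ω̄)^j·(z + ω)^{−k}` — de
  Shalit's `E_{−j,k}(z, L)` **in the absolutely convergent range `k ≥ j + 3`** (formula (6)). HONEST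
  SCOPE: for `k ≤ j + 2` (weights `1` and `2`) the series (6) is not absolutely convergent, `tsum`
  returns a junk value, and de Shalit's `E_{−j,k}` — defined by the operators (5) / Hecke's
  regularisation (II.3.5 proof) — is NOT this number; at `j = 0` those weights are
  `PeriodPair.eisensteinE 1 = ζ − η` and `eisensteinE 2 = ℘ + s₂` of `EisensteinNumbers.lean`.
  -- TODO(general form): `E_{−j,k}` for `j ≥ 1`, `k − j ∈ {1, 2}` (Weil's `𝒟`, Lemma II.3.2).
* `hasSum_eisensteinKronecker` (absolute convergence for `k ≥ j + 3`), `eisensteinKronecker_zero_left`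
  (`j = 0`, `k ≥ 3`: `= eisensteinE k`), `Λ`-periodicity, parity `E_{−j,k}(−z) = (−1)^{j+k}E_{−j,k}(z)`,
  ★ II.3.3 (i) `E_{−j,k}(cz, cL) = c^{−j−k}E_{−j,k}(z, L)` (`A(cL)⁻¹ = (cc̄)⁻¹A(L)⁻¹` absorbs `c̄^j`),
  dependence on the lattice only.

References: E. de Shalit, *Iwasawa theory of elliptic curves with complex multiplication* (1987), II.3.1
(5)–(6), II.3.3 (i) [deShalit1987]; A. Weil, *Elliptic functions according to Eisenstein and Kronecker*
(1976), VI §4, VIII §14.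

Mathlib / tree search: `lean search 'eisensteinKronecker|EisensteinKronecker|kroneckerE'` (only the
weight-one Gaussian-lattice `GaussianLattice.kroneckerE₁`); Mathlib `ZLattice.summable_norm_sub_zpow`,
`PeriodPair.finrank_lattice`; tree `areaInv_mulLeft`, `areaInv_eq_of_lattice_eq`, `eisensteinE_eq_tsum`,
`latticeMulLeftEquiv`.
-/

noncomputable section

open Complex
open scoped ComplexConjugate Nat

namespace PeriodPair

variable {L L' : PeriodPair}

/-- **de Shalit's two-index Eisenstein–Kronecker number `E_{−j,k}(z, L)` in the absolutely convergent
range** (II.3.1 (6)): `(k−1)!·A(L)^{−j}·Σ_{ω ∈ L}(z̄ + ω̄)^j·(z + ω)^{−k}` (`j` = number of conjugate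
factors, weight `k − j`). This IS de Shalit's number for `k ≥ j + 3`; for `k ≤ j + 2` the `tsum` is a
junk value (the printed number there is Hecke-regularised — not defined here; `j = 0` lives in
`PeriodPair.eisensteinE`). A deliberate dot-notation extension of Mathlib's `PeriodPair`.
[cite: deShalit1987, II.3.1 (6)] -/
def eisensteinKronecker (L : PeriodPair) (j k : ℕ) (z : ℂ) : ℂ :=
  ((k - 1)! : ℂ) * L.areaInv ^ j * ∑' ω : L.lattice, conj (z + ω) ^ j * ((z + ω) ^ k)⁻¹

/-- Unfolding lemma for `eisensteinKronecker`. [cite: deShalit1987, II.3.1 (6)] -/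
theorem eisensteinKronecker_def (L : PeriodPair) (j k : ℕ) (z : ℂ) :
    L.eisensteinKronecker j k z =
      ((k - 1)! : ℂ) * L.areaInv ^ j * ∑' ω : L.lattice, conj (z + ω) ^ j * ((z + ω) ^ k)⁻¹ := rfl

/-- The general term of (6) is bounded by `‖z + ω‖^{j−k}` (equality off the lattice point `ω = −z`).
[cite: deShalit1987, II.3.1 (6)] -/
theorem norm_conj_pow_mul_inv_pow_le (j k : ℕ) (w : ℂ) :
    ‖conj w ^ j * (w ^ k)⁻¹‖ ≤ ‖w‖ ^ ((j : ℤ) - k) := by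
  rcases eq_or_ne w 0 with rfl | hw
  · rcases Nat.eq_zero_or_pos k with rfl | hk
    · rcases Nat.eq_zero_or_pos j with rfl | hj
      · simp
      · simp [zero_pow hj.ne']
    · simp only [zero_pow hk.ne', inv_zero, mul_zero, norm_zero]
      exact zpow_nonneg le_rfl _
  · rw [norm_mul, norm_pow, Complex.norm_conj, norm_inv, norm_pow, zpow_sub₀ (norm_ne_zero_iff.mpr hw),
      zpow_natCast, zpow_natCast, div_eq_mul_inv]

/-- **Absolute convergence of (6) for `k ≥ j + 3`** ("`k + j ≥ 3`" in de Shalit's signed indexing):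
the terms are `O(‖ω‖^{j−k})` with `j − k ≤ −3`. [cite: deShalit1987, II.3.1 (6)] -/
theorem hasSum_eisensteinKronecker (L : PeriodPair) {j k : ℕ} (hk : j + 3 ≤ k) (z : ℂ) :
    HasSum (fun ω : L.lattice ↦ ((k - 1)! : ℂ) * L.areaInv ^ j * (conj (z + ω) ^ j * ((z + ω) ^ k)⁻¹))
      (L.eisensteinKronecker j k z) := by
  rw [eisensteinKronecker_def, ← tsum_mul_left]
  refine (Summable.hasSum ?_)
  refine Summable.mul_left _ (.of_norm_bounded (ZLattice.summable_norm_sub_zpow L.lattice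
    ((j : ℤ) - k) (by rw [finrank_lattice]; push_cast; omega) (-z)) fun ω ↦ ?_)
  rw [sub_neg_eq_add, add_comm]
  exact norm_conj_pow_mul_inv_pow_le j k _

/-- **`j = 0`: `E_{0,k} = E_k`** (`k ≥ 3`; both are `(k−1)!·Σ_{ω}(z+ω)^{−k}`, `eisensteinE_eq_tsum`).
[cite: deShalit1987, II.3.1 (5)–(6)] -/
theorem eisensteinKronecker_zero_left (L : PeriodPair) {k : ℕ} (hk : 3 ≤ k) (z : ℂ) :
    L.eisensteinKronecker 0 k z = L.eisensteinE k z := by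
  rw [eisensteinKronecker_def, L.eisensteinE_eq_tsum hk]
  simp

/-- **`E_{−j,k}(·, L)` is `Λ`-periodic** (reindex `ω ↦ ω + l`). [cite: deShalit1987, II.3.1 (6)] -/
theorem eisensteinKronecker_add_coe (L : PeriodPair) (j k : ℕ) (z : ℂ) (l : L.lattice) :
    L.eisensteinKronecker j k (z + l) = L.eisensteinKronecker j k z := by
  have key : ∑' ω : L.lattice, conj (z + l + ω) ^ j * ((z + l + ω) ^ k)⁻¹ =
      ∑' ω : L.lattice, conj (z + ω) ^ j * ((z + ω) ^ k)⁻¹ := by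
    rw [← (Equiv.addRight l).tsum_eq (fun ω : L.lattice ↦ conj (z + (ω : ℂ)) ^ j * ((z + (ω : ℂ)) ^ k)⁻¹)]
    refine tsum_congr fun ω ↦ ?_
    simp only [Equiv.coe_addRight, Submodule.coe_add]
    ring_nf
  rw [eisensteinKronecker_def, eisensteinKronecker_def, key]

/-- `E_{−j,k}(z + l, L) = E_{−j,k}(z, L)` for `l ∈ Λ`. [cite: deShalit1987, II.3.1 (6)] -/
theorem eisensteinKronecker_add_of_mem_lattice (L : PeriodPair) (j k : ℕ) {l : ℂ} (hl : l ∈ L.lattice)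
    (z : ℂ) : L.eisensteinKronecker j k (z + l) = L.eisensteinKronecker j k z :=
  L.eisensteinKronecker_add_coe j k z ⟨l, hl⟩

/-- **Parity: `E_{−j,k}(−z, L) = (−1)^{j+k}E_{−j,k}(z, L)`** (reindex `ω ↦ −ω`).
[cite: deShalit1987, II.3.1 (6)] -/
theorem eisensteinKronecker_neg (L : PeriodPair) (j k : ℕ) (z : ℂ) :
    L.eisensteinKronecker j k (-z) = (-1) ^ (j + k) * L.eisensteinKronecker j k z := by
  have key : ∑' ω : L.lattice, conj (-z + ω) ^ j * ((-z + ω) ^ k)⁻¹ =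
      (-1) ^ (j + k) * ∑' ω : L.lattice, conj (z + ω) ^ j * ((z + ω) ^ k)⁻¹ := by
    rw [← (Equiv.neg L.lattice).tsum_eq (fun ω : L.lattice ↦ conj (-z + (ω : ℂ)) ^ j * ((-z + (ω : ℂ)) ^ k)⁻¹),
      ← tsum_mul_left]
    refine tsum_congr fun ω ↦ ?_
    rw [Equiv.neg_apply, Submodule.coe_neg, show (-z + -(ω : ℂ)) = -(z + ω) by ring, map_neg, neg_pow,
      neg_pow (z + (ω : ℂ)), mul_inv, ← inv_pow, inv_neg, inv_one, pow_add]
    ring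
  rw [eisensteinKronecker_def, eisensteinKronecker_def, key]
  ring

/-- **II.3.3 (i): `E_{−j,k}(cz, cL) = c^{−j−k}·E_{−j,k}(z, L)`** for `c ≠ 0` (de Shalit's
`c^{j−k}` with signed `j ≤ 0`): `A(cL)⁻¹ = (cc̄)⁻¹A(L)⁻¹` absorbs the `c̄^j` of the conjugate factors.
[cite: deShalit1987, II.3.3 (i)] -/
theorem eisensteinKronecker_mulLeft (L : PeriodPair) {c : ℂ} (hc : c ≠ 0) (j k : ℕ) (z : ℂ) :
    (L.mulLeft c hc).eisensteinKronecker j k (c * z) = (c ^ (j + k))⁻¹ * L.eisensteinKronecker j k z := by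
  have hcc : conj c ≠ 0 := (map_ne_zero _).mpr hc
  rw [eisensteinKronecker_def, eisensteinKronecker_def, L.areaInv_mulLeft hc,
    ← (L.latticeMulLeftEquiv c hc).tsum_eq]
  have hterm : ∀ ω : L.lattice,
      conj (c * z + (L.latticeMulLeftEquiv c hc ω : ℂ)) ^ j * ((c * z + (L.latticeMulLeftEquiv c hc ω : ℂ)) ^ k)⁻¹
        = conj c ^ j * (c ^ k)⁻¹ * (conj (z + ω) ^ j * ((z + ω) ^ k)⁻¹) := by
    intro ω
    rw [coe_latticeMulLeftEquiv, show c * z + c * (ω : ℂ) = c * (z + ω) by ring, map_mul, mul_pow,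
      mul_pow, mul_inv]
    ring
  simp_rw [hterm]
  rw [tsum_mul_left, mul_pow, mul_inv, pow_add, mul_inv]
  have h1 : ((c * conj c)⁻¹) ^ j * conj c ^ j = (c ^ j)⁻¹ := by
    rw [← mul_pow, mul_inv, mul_assoc, inv_mul_cancel₀ hcc, mul_one, inv_pow]
  linear_combination (((k - 1)! : ℂ) * L.areaInv ^ j * (c ^ k)⁻¹ *
    ∑' ω : L.lattice, conj (z + (ω : ℂ)) ^ j * ((z + ω) ^ k)⁻¹) * h1

/-- **`E_{−j,k}(·, L)` depends only on the lattice `Λ(L)`.** [cite: deShalit1987, II.3.1 (6)] -/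
theorem eisensteinKronecker_eq_of_lattice_eq (h : L.lattice = L'.lattice) :
    L.eisensteinKronecker = L'.eisensteinKronecker := by
  funext j k z
  rw [eisensteinKronecker_def, eisensteinKronecker_def, areaInv_eq_of_lattice_eq h]
  congr 1
  exact (Equiv.subtypeEquivProp congr(($h : Set ℂ))).tsum_eq
    fun ω : L'.lattice ↦ conj (z + (ω : ℂ)) ^ j * ((z + ω) ^ k)⁻¹

end PeriodPair

end
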